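import Mathlib
import HarnessLib

/-!
# Route `KLProgramme` — ENGINE child gen 8 (stmt-HubbardSuperconductivity-20437 `KLRegimeEngineV17F2`), skeleton v2 class #3 witness input GAP L2
# («SHARP soft-covariance sector data», p5 g6 E5-GAIN §10 r10; owner k3c2-p2 per plan g17 (R47i)): the β-UNIFORM DYADIC mechanism, abstract form
# (cell gate-hubbard-kl, seat hubbard-kl-k3c2-p2 g8, value/(T) lane)

WHY.  The tree's soft-line sector data (`gram_entry_klSoftCov_bgmFat_klEng`, k3c2-p3) treats the soft covariance `D_{n′} = C^K_{(Λ_{n_β+1}, Λ_{n′}]}` as ONE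
slice and pays `sup_{slice} 1/ρ × (whole sector mass) = (1/Λ_{n_β+1})·(C·Λ_n²·w_n)`, i.e. the factor `Λ_n/Λ_{n_β+1} = 4^{n_β+1−n}` over the sharp
`C·Λ_n·w_n ≍ e₀·8^{−n}`.  The sharp law comes from resolving the sector mass DYADICALLY in the radius `ρ = √(ω² + e²)`: on the annulus
`(r/2, r]` the symbol is `≤ 2/r` while the mass is `≤ C·r²` (thin curved box of width `w_n` and radial extent `r` in both `e` and `ω`), so each annulus
costs `≤ 2C·r` and the dyadic sum telescopes to `≤ 4C·Λ` — uniformly in the temperature floor `ρ ≥ π/β` (the number of annuli is `≍ log(Λβ)` but the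
terms are geometric).  This file is that mechanism over an abstract finite carrier, so that the model layer (successor: the annulus-mass lemma for
`bgmFatMultiplier`/`klAnisoFamily` sectors in `BandSectorCounting` currency + the entry formula of `…SectorSliceGramFat`) plugs in ONE hypothesis:

* bookkeeping (`dyadicShell_disjoint`, `exists_mem_dyadicShell`): every supported point with `ρ x ≤ Λ` lies in exactly one annulus
  `Λ·2^{−(i+1)} < ρ x ≤ Λ·2^{−i}`, `i < I`, once `Λ·2^{−I} < ρ_min ≤ ρ x`;
* **`sum_div_radius_le_of_dyadic_mass`** — `f ≥ 0`, `ρ > 0` on the support, `ρ x ≤ Λ` and `ρ_min ≤ ρ x` for `f x ≠ 0`, `Λ·2^{−I} < ρ_min`, and the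
  ANNULUS-MASS hypothesis `∀ i < I, Σ_{x : Λ2^{−(i+1)} < ρ x ≤ Λ2^{−i}} f x ≤ C·(Λ·2^{−i})²` ⟹ `Σ_x f x / ρ x ≤ 4·C·Λ` (β-, I-uniform);
* `sum_div_radius_le_of_dyadic_mass'` — the same with the mass hypothesis for EVERY radius `r ∈ (0, Λ]` (`Σ_{r/2 < ρ ≤ r} f ≤ C r²`), the form a
  lattice-point count delivers.

Pure finite sums; nothing about the model is asserted; nothing asserts superconductivity.
-/

noncomputable section

namespace Summit.HubbardSuperconductivity.HubbardSuperconductivity.Theorems.KLRegimeSplit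

set_option linter.dupNamespace false -- summit = problem name (single-conjunct summit), D-0017

open Real Finset

variable {ι : Type*} (s : Finset ι) (f ρ : ι → ℝ)

variable {s f ρ}

/-- The dyadic annuli are pairwise disjoint. -/
theorem dyadicShell_disjoint {Λ : ℝ} (hΛ : 0 < Λ) {i j : ℕ} (hij : i ≠ j) :
    Disjoint (s.filter fun x => Λ * ((2 : ℝ) ^ (i + 1))⁻¹ < ρ x ∧ ρ x ≤ Λ * ((2 : ℝ) ^ i)⁻¹)
      (s.filter fun x => Λ * ((2 : ℝ) ^ (j + 1))⁻¹ < ρ x ∧ ρ x ≤ Λ * ((2 : ℝ) ^ j)⁻¹) := by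
  wlog h : i < j generalizing i j
  · exact (this hij.symm (lt_of_le_of_ne (not_lt.1 h) hij.symm)).symm
  rw [Finset.disjoint_left]
  intro x hx hx'
  rw [mem_filter] at hx hx'
  -- `ρ x ≤ Λ 2^{-j} ≤ Λ 2^{-(i+1)} < ρ x`
  have hji : i + 1 ≤ j := h
  have hpow : ((2 : ℝ) ^ j)⁻¹ ≤ ((2 : ℝ) ^ (i + 1))⁻¹ :=
    inv_anti₀ (by positivity) (pow_le_pow_right₀ (by norm_num) hji)
  have := mul_le_mul_of_nonneg_left hpow hΛ.le
  linarith [hx.2.1, hx'.2.2]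

/-- **Every supported point below `Λ` and above the floor lies in some annulus `i < I`** once `Λ·2^{−I} < ρ_min`. -/
theorem exists_mem_dyadicShell {Λ ρmin : ℝ} {I : ℕ} (hI : Λ * ((2 : ℝ) ^ I)⁻¹ < ρmin) {x : ι} (hx : x ∈ s)
    (hlo : ρmin ≤ ρ x) (hhi : ρ x ≤ Λ) :
    ∃ i < I, x ∈ (s.filter fun x => Λ * ((2 : ℝ) ^ (i + 1))⁻¹ < ρ x ∧ ρ x ≤ Λ * ((2 : ℝ) ^ i)⁻¹) := by
  -- the set of `i ≤ I` with `ρ x ≤ Λ 2^{-i}` contains `0` and not `I`; take its largest element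
  classical
  set T : Finset ℕ := (Finset.range (I + 1)).filter fun i => ρ x ≤ Λ * ((2 : ℝ) ^ i)⁻¹ with hT
  have h0 : 0 ∈ T := by
    rw [hT, mem_filter]; exact ⟨by simp, by simpa using hhi⟩
  have hne : T.Nonempty := ⟨0, h0⟩
  set i := T.max' hne with hi
  have hiT : i ∈ T := Finset.max'_mem T hne
  rw [hT, mem_filter, mem_range] at hiT
  have hiI : i < I := by
    rcases Nat.lt_or_ge i I with h | h
    · exact h
    · exfalso
      have : i = I := by omega
      rw [this] at hiT
      linarith [hiT.2]
  refine ⟨i, hiI, ?_⟩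
  rw [mem_filter]
  refine ⟨hx, ?_, hiT.2⟩
  -- if `ρ x ≤ Λ 2^{-(i+1)}` then `i+1 ∈ T`, contradicting maximality
  by_contra hc
  rw [not_lt] at hc
  have hmem : i + 1 ∈ T := by
    rw [hT, mem_filter, mem_range]; exact ⟨by omega, hc⟩
  have := Finset.le_max' T (i + 1) hmem
  rw [← hi] at this
  omega

/-- **The β-uniform dyadic bound.**  `f ≥ 0` on `s`; every `x ∈ s` with `f x ≠ 0` has `ρmin ≤ ρ x ≤ Λ` (`0 < ρmin`); `Λ·2^{−I} < ρmin`; and on every annulus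
`i < I` the mass is `Σ_{shell i} f ≤ C·(Λ·2^{−i})²`.  Then `Σ_{x∈s} f x / ρ x ≤ 4·C·Λ` (any floor `ρmin`, e.g. `π/β`). -/
theorem sum_div_radius_le_of_dyadic_mass {Λ ρmin C : ℝ} (hΛ : 0 < Λ) (hC : 0 ≤ C) {I : ℕ}
    (hI : Λ * ((2 : ℝ) ^ I)⁻¹ < ρmin) (hf : ∀ x ∈ s, 0 ≤ f x)
    (hsupp : ∀ x ∈ s, f x ≠ 0 → ρmin ≤ ρ x ∧ ρ x ≤ Λ)
    (hmass : ∀ i < I, ∑ x ∈ (s.filter fun x => Λ * ((2 : ℝ) ^ (i + 1))⁻¹ < ρ x ∧ ρ x ≤ Λ * ((2 : ℝ) ^ i)⁻¹), f x ≤ C * (Λ * ((2 : ℝ) ^ i)⁻¹) ^ 2) :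
    ∑ x ∈ s, f x / ρ x ≤ 4 * C * Λ := by
  classical
  -- restrict to the support, covered by the disjoint union of the annuli
  set U : Finset ι := (Finset.range I).biUnion fun i => (s.filter fun x => Λ * ((2 : ℝ) ^ (i + 1))⁻¹ < ρ x ∧ ρ x ≤ Λ * ((2 : ℝ) ^ i)⁻¹) with hU
  have hUs : U ⊆ s := by
    intro x hx
    rw [hU, mem_biUnion] at hx
    obtain ⟨i, -, hxi⟩ := hx
    exact (mem_filter.1 hxi).1
  have hzero : ∀ x ∈ s, x ∉ U → f x / ρ x = 0 := by
    intro x hx hxU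
    by_cases hfx : f x = 0
    · simp [hfx]
    · exfalso
      obtain ⟨hlo, hhi⟩ := hsupp x hx hfx
      obtain ⟨i, hiI, hxi⟩ := exists_mem_dyadicShell (s := s) (ρ := ρ) hI hx hlo hhi
      exact hxU (by rw [hU, mem_biUnion]; exact ⟨i, mem_range.2 hiI, hxi⟩)
  rw [← Finset.sum_subset hUs (fun x hx hxU => hzero x hx hxU)]
  rw [hU, Finset.sum_biUnion (fun i _ j _ hij => dyadicShell_disjoint hΛ hij)]
  -- per annulus: `Σ f/ρ ≤ (2^{i+1}/Λ)·C·(Λ2^{-i})² = 2C·Λ·2^{-i}`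
  have hann : ∀ i ∈ range I, ∑ x ∈ (s.filter fun x => Λ * ((2 : ℝ) ^ (i + 1))⁻¹ < ρ x ∧ ρ x ≤ Λ * ((2 : ℝ) ^ i)⁻¹), f x / ρ x ≤ 2 * C * Λ * ((2 : ℝ) ^ i)⁻¹ := by
    intro i hi
    have hr : 0 < Λ * ((2 : ℝ) ^ (i + 1))⁻¹ := by positivity
    calc ∑ x ∈ (s.filter fun x => Λ * ((2 : ℝ) ^ (i + 1))⁻¹ < ρ x ∧ ρ x ≤ Λ * ((2 : ℝ) ^ i)⁻¹), f x / ρ x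
          ≤ ∑ x ∈ (s.filter fun x => Λ * ((2 : ℝ) ^ (i + 1))⁻¹ < ρ x ∧ ρ x ≤ Λ * ((2 : ℝ) ^ i)⁻¹), f x / (Λ * ((2 : ℝ) ^ (i + 1))⁻¹) := by
          refine sum_le_sum fun x hx => ?_
          obtain ⟨hxs, hlo, -⟩ := mem_filter.1 hx
          exact div_le_div_of_nonneg_left (hf x hxs) hr hlo.le
      _ = (∑ x ∈ (s.filter fun x => Λ * ((2 : ℝ) ^ (i + 1))⁻¹ < ρ x ∧ ρ x ≤ Λ * ((2 : ℝ) ^ i)⁻¹), f x) / (Λ * ((2 : ℝ) ^ (i + 1))⁻¹) := by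
          rw [Finset.sum_div]
      _ ≤ C * (Λ * ((2 : ℝ) ^ i)⁻¹) ^ 2 / (Λ * ((2 : ℝ) ^ (i + 1))⁻¹) :=
          div_le_div_of_nonneg_right (hmass i (mem_range.1 hi)) hr.le
      _ = 2 * C * Λ * ((2 : ℝ) ^ i)⁻¹ := by
          field_simp
          ring
  refine (sum_le_sum hann).trans ?_
  rw [← Finset.mul_sum]
  have hgeo : ∑ i ∈ range I, ((2 : ℝ) ^ i)⁻¹ ≤ 2 := by
    have h := geom_sum_Ico_le_of_lt_one (m := 0) (n := I) (x := (2 : ℝ)⁻¹) (by norm_num) (by norm_num)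
    rw [← Finset.range_eq_Ico] at h
    simp only [inv_pow] at h ⊢
    refine h.trans ?_
    norm_num
  have h0 : 0 ≤ 2 * C * Λ := by positivity
  nlinarith [mul_le_mul_of_nonneg_left hgeo h0]

/-- **The same with the mass hypothesis at EVERY radius `0 < r ≤ Λ`** (`Σ_{r/2 < ρ ≤ r} f ≤ C·r²`) — the shape a lattice-point count in a thin curved
box delivers; the number of annuli `I` is chosen inside (`Λ·2^{−I} < ρmin`). -/
theorem sum_div_radius_le_of_dyadic_mass' {Λ ρmin C : ℝ} (hΛ : 0 < Λ) (hρmin : 0 < ρmin) (hC : 0 ≤ C) (hf : ∀ x ∈ s, 0 ≤ f x)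
    (hsupp : ∀ x ∈ s, f x ≠ 0 → ρmin ≤ ρ x ∧ ρ x ≤ Λ)
    (hmass : ∀ r : ℝ, 0 < r → r ≤ Λ → ∑ x ∈ s.filter (fun x => r / 2 < ρ x ∧ ρ x ≤ r), f x ≤ C * r ^ 2) :
    ∑ x ∈ s, f x / ρ x ≤ 4 * C * Λ := by
  -- choose `I` with `Λ 2^{-I} < ρmin`
  obtain ⟨I, hI⟩ : ∃ I : ℕ, Λ * ((2 : ℝ) ^ I)⁻¹ < ρmin := by
    obtain ⟨I, hI⟩ := pow_unbounded_of_one_lt (Λ / ρmin) (by norm_num : (1 : ℝ) < 2)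
    refine ⟨I, ?_⟩
    rw [div_lt_iff₀ hρmin] at hI
    have h2 : (0 : ℝ) < (2 : ℝ) ^ I := by positivity
    calc Λ * ((2 : ℝ) ^ I)⁻¹ = Λ / (2 : ℝ) ^ I := by rw [div_eq_mul_inv]
      _ < ρmin := by rw [div_lt_iff₀ h2]; linarith
  refine sum_div_radius_le_of_dyadic_mass hΛ hC hI hf hsupp fun i _ => ?_
  have hr : 0 < Λ * ((2 : ℝ) ^ i)⁻¹ := by positivity
  have hrΛ : Λ * ((2 : ℝ) ^ i)⁻¹ ≤ Λ := by
    have : ((2 : ℝ) ^ i)⁻¹ ≤ 1 := inv_le_one_of_one_le₀ (one_le_pow₀ (by norm_num))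
    nlinarith
  have heq : (s.filter fun x => Λ * ((2 : ℝ) ^ (i + 1))⁻¹ < ρ x ∧ ρ x ≤ Λ * ((2 : ℝ) ^ i)⁻¹) =
      s.filter (fun x => Λ * ((2 : ℝ) ^ i)⁻¹ / 2 < ρ x ∧ ρ x ≤ Λ * ((2 : ℝ) ^ i)⁻¹) := by
    congr 1
    ext x
    have : Λ * ((2 : ℝ) ^ (i + 1))⁻¹ = Λ * ((2 : ℝ) ^ i)⁻¹ / 2 := by rw [pow_succ]; field_simp
    rw [this]
  rw [heq]
  exact hmass _ hr hrΛ

end Summit.HubbardSuperconductivity.HubbardSuperconductivity.Theorems.KLRegimeSplit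

end
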